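/-
Copyright: the b2b-balaban cell (near-miss cell 7), T⁴-continuum CRUX team (coordinator ruling e34b3e0c item (2)),
row NE7b, seat t4-ne7b-formalise-leaf-06 (gen 144) for the OWNER lineage `t4-ne7b-p1`'s IR-103-2 «count DERIVED»
(memo `t4/b2b-balaban-t4-ne7b-p1/g103/F-RHO-TOWER-g103.md` §7 REFINED (b), rulings W-ne7bp1-g103-4 C-4 ∕ W-ne7bp1-g103-5 (2); the PINNED form of
leaf-01 g77's END (B, label-guarded) of the tower's P∕W∕T chain — the socket the tower END `Support/B16HistoryTowerExtractionEnd2` consumes).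
Released under the licence of the surrounding project.
-/
import Summits.QuantumFields.BalabanUV.T4Continuum.Spine.NE7b.RealisedEndRelPDWTL
import Summits.QuantumFields.BalabanUV.T4Continuum.Support.HistoryRealiseCellsRunPinnedT3bPWTL

/-!
# Realised histories: THE PINNED `_rel` END — the P∕W∕T END RE-CUT at the RELATIVE member-key display, UNDER THE PIN `BetaPertHyp`, the
multiplicity's level paid by the coupling threshold (IR-103-2 «count DERIVED»; the `_rel` twin of leaf-02's L2 `HistoryRealiseCellsRunPinnedT3bPWTL`)

Crux-route work under `Spine/NE7b/` of the T⁴-continuum cell (rung (B)+1 on a FINITE torus only; NOT infinite volume, NOT the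
mass gap, NOT the Clay statement; NOT a proof of the spine estimate NE7b — `T4WeightBudget.RelWeightBound`, the cell's OWN
estimate, NOT PRINTED, NOT PROVED).  [folklore] COMPOSITION BY NAME; one theorem; no definition, no `Prop` of Bałaban's minted,
no `[cite:]` tag, zero `sorry`.  Typed by the third-named typist of IR-103-2 (b) (leaf-06 g144, INTENT I-leaf06-g144-1, journal l.51194)
as the socket of `Support/B16HistoryTowerExtractionEnd2`; lane and name at the OWNER's word (C-1 of the INTENT).

WHY.  The headline path pins the END: leaf-02's L2 `HistoryRealiseCellsRunPinnedT3bPWTL.hybridNE7_of_realisedDomainsRunW_pinnedT3bPDTL`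
discharges the flow binders of `HistoryRealiseCellsRunMultEndPDWTL.…T3bPDTL` from `BetaPertHyp`, its (B)-side witness from the pin `(B)`,
and the infrared clause together with THE LEVEL (`hP1 ∕ hP ∕ hθJ`) on a coupling window.  The OWNER re-cut the END at the RELATIVE display
(leaf-01 g77's `RealisedEndRelPDWTL.hybridNE7_of_realisedDomainsRunW_printedT3bPDTL_rel`: NO (B)-side rows, no envelopes, no term-wise
numerator rows; instead `hA0 hA0′`, one relative quotient per physical member-key family `hqA ∕ hqB`, the two RELATIVE DISPLAYS `fibM ∕ fibM′`
and the price sentences `hPq ∕ hPq′`; envelope constant `1`).  THIS FILE pins THAT END the same way — minus everything (B)-side: there is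
nothing to discharge from `(B)` any more.

WHAT.  **`hybridNE7_of_realisedDomainsRunW_pinnedT3bPDTL_rel`**: binders = L2's constants-side binders verbatim (`ThresholdOK`, `0 < C.μ`,
the κ₁∕E₀ largeness, `1 ≤ A₀`, `0 < β₀`, `L·β₀ ≤ 1`, `13 ≤ n₁`, `0 < n`, `0 < θ` with `C.a + θ ≤ ½γ₀A₁²`, `0 < E₂`, `0 ≤ E₃`, row S6g′'s
`sS ∕ θc` arithmetic) with the ONE pin `hβ : BetaPertHyp D.βfun` (NO `hB`, NO `hsign`); conclusion = L2's threshold prefix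
`∃ γ₁ > 0, ∀ γ ∈ ]0, γ₁], ∃ g₁ > 0, ∀ g ∈ ]0, g₁], ∀ g₀, D.Tuned γ g g₀ → …` WITHOUT the `Em` layer, followed by the `_rel` END's binder
list verbatim minus `hir hP1 hP hθJ` (data; the (2.5) size function; the READING `RealisedDomainsRW` with `hstep ∕ hDJ ∕ hBB`; the realised
costs `κ κ′ hκ hκ′`; the RE-CUT numerator side `hA0 hA0′ qA qB hqA hqB fibM fibM′ hPq hPq′`; NE7c's `ShellWeightBound`, NE7's
`ReindexedBudget`, four summable rates) and the `_rel` END's conclusion (`1 · recordsBudget …`).  Proof = L2's, line for line: `γ₁ := γf`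
(`HistoryFlow.flowSide_of_betaPertHyp` at `max C.p₀ rr`), `g₁ := min (min 1 (exp (−irThresholdTLE C F.L rr β₀ ∕ 2))) (exp (−(x_Θ + 1) ∕ 2))`
(`HistoryRealiseCellsRunPinned.le_log_inv_sq_of_le_exp`, `HistoryFlowProfileLevel.thresholdPaid_of_coupling` with `x_Θ := max 1 (Θ ∕ (θ·C.A₀))`,
`P := C.A₀·x_Θ^{C.p₀}`), `β₀ ≤ ½` and `4 ≤ F.L` by `HistoryRealiseCellsRunPinned.beta0_le_of_L_mul_le ∕ four_le_L`, then the `_rel` END.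

WHAT REMAINS DISPLAYED (census).  As the `_rel` END's (module docstring of `RealisedEndRelPDWTL`) minus the flow box bounds ∕ tuning ∕
IR smallness ∕ the level — now behind `BetaPertHyp` + the thresholds —: the READING with its clauses, the realised costs, `hqA ∕ hqB`,
**`fibM ∕ fibM′`** (H3^NE7b at partial-sum level, print's KIND — NOT in print) and **`hPq ∕ hPq′`**, NE7c's `ShellWeightBound`, NE7's
`ReindexedBudget`, four rates; the constants-side binders (INHABITED by O(1) constants: `HistoryRealiseCellsRunHeadlineT3bPWTVS.exists_consts_countRoadT3bPWTVS`,
not re-proved here).  BY-NAME EFFECT ON THE WALL: NONE.  NE7b NOT PRINTED ∕ NOT PROVED; spine PROVED 0∕9; rung (B)+1 on a FINITE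
torus — NOT infinite volume, NOT the mass gap, NOT Clay.
HONEST DEPENDENCY (cell): continuum YM on T⁴ ⇐ BetaPertH ∧ nine spine estimates (0/9 proved); BetaPertH ⇐ (D1) ∧ (D4)
∧ CAP+tail; G-an2-4 gates asym, D1 and NE2/3/4.  This file changes none of it.
-/

open Finset MeasureTheory
open Literature.MathematicalPhysics.QuantumFieldTheory.Balaban1983to89
open T4PersistenceDictionary T4PersistentHistoryCount T4BankedInduction T4PrintedShapeBanking
open T4WeightBudget T4GlobalDenominator T4LiveClassFibration T4LiveStructureGas T4LiveGasToTerms T4RecordPriceSeam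
open T4PartnerMultiplicity T4IndicatorShell T4MatchingAssembly T4MatchingClosure T4MatchingClosureSocket T4Continuum
open T4StabilitySocket T4BranchingRecordsGas T4TaggedShapeBanking T4CanonicalMenus T4RenewalChains
open Summit.QuantumFields.BalabanUV.T4Continuum.PlacementBatch
open Summit.QuantumFields.BalabanUV.T4Continuum.PlacementSkeleton
open Summit.QuantumFields.BalabanUV.T4Continuum.CountThresholdUniform
open Summit.QuantumFields.BalabanUV.T4Continuum.CountThresholdExit
open Summit.QuantumFields.BalabanUV.T4Continuum.CountSeamJunction
open Summit.QuantumFields.BalabanUV.T4Continuum.LateMergers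
open Summit.QuantumFields.BalabanUV.T4Continuum.HistoryFlow
open Summit.QuantumFields.BalabanUV.T4Continuum.HistoryRegeneration
open Summit.QuantumFields.BalabanUV.T4Continuum.HistoryTables
open Summit.QuantumFields.BalabanUV.T4Continuum.HistoryAssemblyTrees
open Summit.QuantumFields.BalabanUV.T4Continuum.HistoryAssemblyTerms
open Summit.QuantumFields.BalabanUV.T4Continuum.HistoryAssemblyPedigree
open Summit.QuantumFields.BalabanUV.T4Continuum.HistoryConstants
open Summit.QuantumFields.BalabanUV.T4Continuum.HistoryGen
open Literature.MathematicalPhysics.QuantumFieldTheory.Balaban1983to89.B13ScaleTransfer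
open Summit.QuantumFields.BalabanUV.T4Continuum.ZoneSkeleton
open Summit.QuantumFields.BalabanUV.T4Continuum.HistorySocketTH
open Summit.QuantumFields.BalabanUV.T4Continuum.HistoryCaps
open Summit.QuantumFields.BalabanUV.T4Continuum.HistoryAssemblyPrice
open Summit.QuantumFields.BalabanUV.T4Continuum.HistoryBankingLE
open Summit.QuantumFields.BalabanUV.T4Continuum.HistoryExitLE
open Summit.QuantumFields.BalabanUV.T4Continuum.HistoryAssemblyTreesLE
open Summit.QuantumFields.BalabanUV.T4Continuum.HistoryAssemblyTermsLE
open Summit.QuantumFields.BalabanUV.T4Continuum.HistoryRealise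
open Summit.QuantumFields.BalabanUV.T4Continuum.HistoryAssemblyRealiseLE
open Summit.QuantumFields.BalabanUV.T4Continuum.HistoryAssemblyMult
open Summit.QuantumFields.BalabanUV.T4Continuum.HistoryAssemblyMultKey
open Summit.QuantumFields.BalabanUV.T4Continuum.HistoryAssemblyRealiseRun
open Summit.QuantumFields.BalabanUV.T4Continuum.HistoryAssemblyRealiseMult
open Summit.QuantumFields.BalabanUV.T4Continuum.HistoryZones
open Summit.QuantumFields.BalabanUV.T4Continuum.HistoryRealiseCells
open Summit.QuantumFields.BalabanUV.T4Continuum.HistoryRealiseCellsRun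
open Summit.QuantumFields.BalabanUV.T4Continuum.HistoryAssemblyRealiseRunMult
open Summit.QuantumFields.BalabanUV.T4Continuum.HistoryRealiseCellsRunMult
open Summit.QuantumFields.BalabanUV.T4Continuum.HistoryAssemblyMultInstance
open Summit.QuantumFields.BalabanUV.T4Continuum.HistoryJoinsPlacedMember
open Summit.QuantumFields.BalabanUV.T4Continuum.PlacementSkeleton
open Summit.QuantumFields.BalabanUV.T4Continuum.HistoryJoinsPlacedMult
open Summit.QuantumFields.BalabanUV.T4Continuum.HistoryRealiseDistinct
open Summit.QuantumFields.BalabanUV.T4Continuum.HistoryRegionTemplates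
open Summit.QuantumFields.BalabanUV.T4Continuum.HistoryCaps
open Summit.QuantumFields.BalabanUV.T4Continuum.HistoryZoneEvolve (cth)
open Literature.MathematicalPhysics.QuantumFieldTheory.Balaban1983to89.B16SProfile (DropCtl)
open Summit.QuantumFields.BalabanUV.T4Continuum.HistoryRealiseCellsRunMultEnd
open Summit.QuantumFields.BalabanUV.T4Continuum.HistoryRealiseCellsRunMultP
open Summit.QuantumFields.BalabanUV.T4Continuum.HistoryRealiseCellsRunMultEndP
open Summit.QuantumFields.BalabanUV.T4Continuum.HistoryRealisePrint
open Summit.QuantumFields.BalabanUV.T4Continuum.HistoryRealiseWeak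
open Summit.QuantumFields.BalabanUV.T4Continuum.HistoryRealiseWeakReading
open Summit.QuantumFields.BalabanUV.T4Continuum.HistoryRealiseWeakCells
open Summit.QuantumFields.BalabanUV.T4Continuum.HistoryAssemblyRealiseRunMultW
open Summit.QuantumFields.BalabanUV.T4Continuum.HistoryAssemblyRealiseRunMultPWT
open Summit.QuantumFields.BalabanUV.T4Continuum.HistoryAssemblyMultInstanceW
open Summit.QuantumFields.BalabanUV.T4Continuum.HistoryRealiseCellsRunMultW
open Summit.QuantumFields.BalabanUV.T4Continuum.HistoryRealiseCellsRunMultPWT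
open Summit.QuantumFields.BalabanUV.T4Continuum.HistoryRealiseCellsRunMultEndW
open Summit.QuantumFields.BalabanUV.T4Continuum.HistoryRealiseCellsRunMultEndDW
open Summit.QuantumFields.BalabanUV.T4Continuum.HistoryRealiseCellsRunMultEndPWT
open Summit.QuantumFields.BalabanUV.T4Continuum.HistoryRealiseCellsRunMultEndPD
open Summit.QuantumFields.BalabanUV.T4Continuum.HistoryRealiseDistinctGuarded
open Summit.QuantumFields.BalabanUV.T4Continuum.HistoryAssemblyMultInstanceWL
open Summit.QuantumFields.BalabanUV.T4Continuum.NE7b.RealisedEndRelPWT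
open Summit.QuantumFields.BalabanUV.T4Continuum.HistoryRealiseCellsRunMultEndPDWTL
open Summit.QuantumFields.BalabanUV.T4Continuum.NE7b.RealisedEndRelPDWTL

namespace Summit.QuantumFields.BalabanUV.T4Continuum.NE7b.RealisedPinnedRelPDWTL

noncomputable section

universe u v w

section Pinned

variable {F : T4Family} {G : Type*} [GaugeGroup G] [MeasurableSpace G] [HaarData G]

/-- **NE7b's COUNT EXIT — THE `_rel` END UNDER THE PIN `BetaPertHyp`, THE MULTIPLICITY's LEVEL PAID BY THE COUPLING THRESHOLD**
(the `_rel` twin of leaf-02's L2 `HistoryRealiseCellsRunPinnedT3bPWTL.hybridNE7_of_realisedDomainsRunW_pinnedT3bPDTL`, over leaf-01's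
`RealisedEndRelPDWTL.hybridNE7_of_realisedDomainsRunW_printedT3bPDTL_rel`).  The flow binders `hb hlo hhi hγ hγβ S` (+ `hp₀ hrr hβ`) DISCHARGED
from `hβ : BetaPertHyp D.βfun` (`HistoryFlow.flowSide_of_betaPertHyp` at the exponent `max C.p₀ rr`; `γ₁ := γf`); the infrared clause `hir`
AND THE LEVEL `hP1 : 1 ≤ P`, `hP : ∀ K ≥ K₀, ∀ s ≤ K, P ≤ p0Profile C.A₀ C.p₀ (g_K s)`, `hθJ : Θ ≤ θ·P` DISCHARGED on `]0, g₁]`,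
`g₁ := min (min 1 (exp (−irThresholdTLE C F.L rr β₀ ∕ 2))) (exp (−(x_Θ + 1) ∕ 2))`, `x_Θ := max 1 (Θ ∕ (θ·C.A₀))`, `P := C.A₀·x_Θ^{C.p₀}`
(`HistoryFlowProfileLevel.thresholdPaid_of_coupling` BY NAME); `4 ≤ F.L`, `β₀ ≤ ½` as in L2.  NO `(B)` pin, NO sign conventions, NO `Em`,
NO observable ∕ integral bounds ∕ floors ∕ sites ∕ envelopes — the `_rel` END has no (B)-side input.  Everything after `D.Tuned γ g g₀ →`
is the `_rel` END's binder list verbatim minus `hir hP1 hP hθJ` (data first: families, weights, shells, budget data, rates; then the (2.5)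
size function, the READING with its clauses, the realised costs, the RE-CUT numerator side `hA0 hA0′ qA qB hqA hqB fibM fibM′ hPq hPq′`,
the seam's inputs); conclusion = the `_rel` END's (envelope constant `1`).  CONDITIONAL; NE7b NOT proved. [folklore] -/
theorem hybridNE7_of_realisedDomainsRunW_pinnedT3bPDTL_rel (D : FiniteEpsData F G)
    -- the β-side pin BY NAME (the flow side of the END); NO (B) pin, NO sign conventions: the `_rel` END has no (B) side
    (hβ : BetaPertHyp D.βfun)
    -- the constants (symbolic, c2∕c6) and their side conditions; NO `Dominates` on the slack road
    {C : T4PrintedShapeBanking.Consts} {O : PrintedO1s}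
    {rr : ℕ} {β₀ : ℝ} (h : ThresholdOK C F.L rr β₀) (hμ : 0 < C.μ) (d n : ℕ)
    (hκ₁ : (d : ℝ) * Real.log F.L + 2 * Real.log 2 ≤ C.κ₁) (hE₀ : Real.log (2 + birthMass C) ≤ C.E₀)
    (hA₀ : 1 ≤ C.A₀) (hβ₀ : 0 < β₀) (hLβ : (F.L : ℝ) * β₀ ≤ 1) (hn₁ : 13 ≤ C.n₁) (hn : 0 < n)
    -- the class-linear slack for ANY POSITIVE `θ` (the level `P` with `hθJ : … ≤ θ·P` and the profile clause `hP` are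
    -- DISCHARGED from the coupling threshold), and row S6g′'s instance: stride `sS`, decay `θc`, arithmetic, signs
    {θ : ℝ} (hθ : 0 < θ) (hslack : C.a + θ ≤ O.γ₀ * O.A₁ ^ 2 / 2)
    (hE₂ : 0 < C.E₂) (hE₃ : 0 ≤ C.E₃) {sS : ℕ} (hsS : 1 ≤ sS)
    (hsmall : (((2 * cth 32 1 sS + 1) ^ d : ℕ) : ℝ) * (5 : ℝ) ^ d * ((max 1 (2 * 32 + 2) : ℕ) : ℝ) ≤
      (F.L : ℝ) ^ (sS / 2) / 2)
    {θc : ℝ} (hθc0 : 0 ≤ θc) (hθc1 : θc < 1) (hθcs : 1 / 2 ≤ θc ^ sS) :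
    ∃ γ₁ : ℝ, 0 < γ₁ ∧ ∀ γ : ℝ, 0 < γ → γ ≤ γ₁ → ∃ g₁ : ℝ, 0 < g₁ ∧ ∀ g : ℝ, 0 < g → g ≤ g₁ →
      ∀ g₀ : ℕ → ℝ, D.Tuned γ g g₀ →
      ∀ {ι : Type u} [DecidableEq ι] {α : Type v} {π : Type w} [DecidableEq α] [DecidableEq π]
        (l₀ vol : ℝ) (K₀ : ℕ) (T : ℕ → Finset ι) (A A' shA shB : ℕ → ℝ → ι → ℝ)
        (Cc Rr CcRec RrRec : ℕ → ℝ → ι → ℝ) (ν u s₂ q₀ r s Wsh : ℕ → ℝ),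
      -- the (2.5) side condition on the size function
      ∀ (R : ℕ → ℕ → ℕ),
        (∀ K s, s ≤ K → B14.IsRj F.L rr ((D.C ⟨K, F.m, g₀ K⟩).flow.g s) (R K s)) →
        (∀ K, K₀ ≤ K → ∀ t, 1 ≤ R K t) →
      -- H3: the terms read as pedigrees REALISED BY THE RUN'S OWN PROFILE with their DOMAINS
      ∀ (ped : ℕ → ι → Pedigree α π) (cellP : ℕ → ι → π → Pt d × Finset (Pt d)) (liveC : ℕ → ι → Finset α) (Zd : ℕ → ι → α → Finset (Pt d)),
        RealisedDomainsRW F.L (runProfile F.L R) n K₀ R T ped cellP liveC Zd →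
      -- H3: live components dated no later than the cutoff; the constituents' reading clauses
        (∀ K, K₀ ≤ K → ∀ τ ∈ T K, ∀ c ∈ liveC K τ, (ped K τ).step c ≤ K) →
        (∀ K, K₀ ≤ K → ∀ τ ∈ T K, ∀ c ∈ liveC K τ, DisjointJoinsL ((ped K τ).toPGen (cellP K τ) c)) →
        (∀ K, K₀ ≤ K → ∀ τ ∈ T K, ∀ c ∈ liveC K τ,
          BoxedBirths n F.L K (levelOf (runProfile F.L R K) K) ((ped K τ).toPGen (cellP K τ) c)) →
      -- H3: realised per-step costs of the live members; their LIFE cost read below the model's booked LIFE cost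
      -- (TOTAL form, ruling R-OWNER-42-2 ∕ IR-42-2)
      ∀ (κ κ' : ℕ → (Fin d → ℕ) × Gen (Lab α π) → Gen (Lab α π) → ℕ → ℝ),
        (∀ K, K₀ ≤ K → ∀ τ ∈ badTerms (memOf ped liveC (cellOfR n F.L (runProfile F.L R) ped cellP)) jhalf T K, ∀ q ∈ memOf ped liveC (cellOfR n F.L (runProfile F.L R) ped cellP) K τ,
          lifeCost (padW (dictWT Prod.fst (R K) C.n₁) 0) (κ K q) q.2 ≤
            lifeCost (padW (dictWT Prod.fst (R K) C.n₁) 0) (costT Prod.fst C K (R K)) q.2) →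
        (∀ K, K₀ ≤ K → ∀ τ ∈ badTerms (memOf ped liveC (cellOfR n F.L (runProfile F.L R) ped cellP)) jhalf T K, ∀ q ∈ memOf ped liveC (cellOfR n F.L (runProfile F.L R) ped cellP) K τ,
          lifeCost (padW (dictWT Prod.fst (R K) C.n₁) 0) (κ' K q) q.2 ≤
            lifeCost (padW (dictWT Prod.fst (R K) C.n₁) 0) (costT Prod.fst C K (R K)) q.2) →
      -- H3, RE-CUT (NO (B) side): non-negative weights; ONE RELATIVE quotient per physical member-key family, non-negative on the
      -- bad families; THE TWO RELATIVE DISPLAYS; the price sentences in PRINT's currency at that quotient, discounted — both runs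
        (∀ K t, |t| ≤ l₀ → K₀ ≤ K → ∀ τ ∈ T K, 0 ≤ A K t τ) →
        (∀ K t, |t| ≤ l₀ → K₀ ≤ K → ∀ τ ∈ T K, 0 ≤ A' K t τ) →
      ∀ (qA qB : ℕ → Finset ((Fin d → ℕ) × Gen PEv × Multiset (PEv × ((Fin d → ℕ) × Finset (Pt d)))) → ℝ),
        (∀ K, K₀ ≤ K →
      ∀ k ∈ badGMems (memOf ped liveC (cellOfR n F.L (runProfile F.L R) ped cellP)) jhalf T (kmemOf ped liveC (cellOfR n F.L (runProfile F.L R) ped cellP) (physV n F.L hn (Nat.lt_of_lt_of_le Nat.zero_lt_two (two_le_L F))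
        (fun K => tcap d (dcapOf Prod.fst T (memOf ped liveC (cellOfR n F.L (runProfile F.L R) ped cellP)) K))
        (fun K => one_le_tcap d (dcapOf Prod.fst T (memOf ped liveC (cellOfR n F.L (runProfile F.L R) ped cellP)) K)) (runProfile F.L R) ped cellP)) K, 0 ≤ qA K k) →
        (∀ K, K₀ ≤ K →
      ∀ k ∈ badGMems (memOf ped liveC (cellOfR n F.L (runProfile F.L R) ped cellP)) jhalf T (kmemOf ped liveC (cellOfR n F.L (runProfile F.L R) ped cellP) (physV n F.L hn (Nat.lt_of_lt_of_le Nat.zero_lt_two (two_le_L F))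
        (fun K => tcap d (dcapOf Prod.fst T (memOf ped liveC (cellOfR n F.L (runProfile F.L R) ped cellP)) K))
        (fun K => one_le_tcap d (dcapOf Prod.fst T (memOf ped liveC (cellOfR n F.L (runProfile F.L R) ped cellP)) K)) (runProfile F.L R) ped cellP)) K, 0 ≤ qB K k) →
        (∀ K t, |t| ≤ l₀ → K₀ ≤ K →
      ∀ k ∈ badGMems (memOf ped liveC (cellOfR n F.L (runProfile F.L R) ped cellP)) jhalf T (kmemOf ped liveC (cellOfR n F.L (runProfile F.L R) ped cellP) (physV n F.L hn (Nat.lt_of_lt_of_le Nat.zero_lt_two (two_le_L F))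
        (fun K => tcap d (dcapOf Prod.fst T (memOf ped liveC (cellOfR n F.L (runProfile F.L R) ped cellP)) K))
        (fun K => one_le_tcap d (dcapOf Prod.fst T (memOf ped liveC (cellOfR n F.L (runProfile F.L R) ped cellP)) K)) (runProfile F.L R) ped cellP)) K,
        ∑ τ ∈ fibre (kmemOf ped liveC (cellOfR n F.L (runProfile F.L R) ped cellP) (physV n F.L hn (Nat.lt_of_lt_of_le Nat.zero_lt_two (two_le_L F))
        (fun K => tcap d (dcapOf Prod.fst T (memOf ped liveC (cellOfR n F.L (runProfile F.L R) ped cellP)) K))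
        (fun K => one_le_tcap d (dcapOf Prod.fst T (memOf ped liveC (cellOfR n F.L (runProfile F.L R) ped cellP)) K)) (runProfile F.L R) ped cellP)) T K k, A K t τ ≤
          qA K k * ∑ σ ∈ T K, A K t σ) →
        (∀ K t, |t| ≤ l₀ → K₀ ≤ K →
      ∀ k ∈ badGMems (memOf ped liveC (cellOfR n F.L (runProfile F.L R) ped cellP)) jhalf T (kmemOf ped liveC (cellOfR n F.L (runProfile F.L R) ped cellP) (physV n F.L hn (Nat.lt_of_lt_of_le Nat.zero_lt_two (two_le_L F))
        (fun K => tcap d (dcapOf Prod.fst T (memOf ped liveC (cellOfR n F.L (runProfile F.L R) ped cellP)) K))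
        (fun K => one_le_tcap d (dcapOf Prod.fst T (memOf ped liveC (cellOfR n F.L (runProfile F.L R) ped cellP)) K)) (runProfile F.L R) ped cellP)) K,
        ∑ τ ∈ fibre (kmemOf ped liveC (cellOfR n F.L (runProfile F.L R) ped cellP) (physV n F.L hn (Nat.lt_of_lt_of_le Nat.zero_lt_two (two_le_L F))
        (fun K => tcap d (dcapOf Prod.fst T (memOf ped liveC (cellOfR n F.L (runProfile F.L R) ped cellP)) K))
        (fun K => one_le_tcap d (dcapOf Prod.fst T (memOf ped liveC (cellOfR n F.L (runProfile F.L R) ped cellP)) K)) (runProfile F.L R) ped cellP)) T K k, A' K t τ ≤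
          qB K k * ∑ σ ∈ T K, A' K t σ) →
        (∀ K t, |t| ≤ l₀ → K₀ ≤ K → ∀ τ ∈ badTerms (memOf ped liveC (cellOfR n F.L (runProfile F.L R) ped cellP)) jhalf T K,
      qA K (kmemOf ped liveC (cellOfR n F.L (runProfile F.L R) ped cellP) (physV n F.L hn (Nat.lt_of_lt_of_le Nat.zero_lt_two (two_le_L F))
        (fun K => tcap d (dcapOf Prod.fst T (memOf ped liveC (cellOfR n F.L (runProfile F.L R) ped cellP)) K))
        (fun K => one_le_tcap d (dcapOf Prod.fst T (memOf ped liveC (cellOfR n F.L (runProfile F.L R) ped cellP)) K)) (runProfile F.L R) ped cellP) K τ) ≤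
        ∏ q ∈ memOf ped liveC (cellOfR n F.L (runProfile F.L R) ped cellP) K τ,
          pshapeTH Prod.fst O C 1 1 (R K) (D.C ⟨K, F.m, g₀ K⟩).flow.g 0 (κ K q) q.2 * Real.exp (-(8 / C.E₂ * totalCostT Prod.fst C K (R K) q.2 + 4 * (partnerAges (PEv.step ∘ Prod.fst) q.2 : ℝ)))) →
        (∀ K t, |t| ≤ l₀ → K₀ ≤ K → ∀ τ ∈ badTerms (memOf ped liveC (cellOfR n F.L (runProfile F.L R) ped cellP)) jhalf T K,
      qB K (kmemOf ped liveC (cellOfR n F.L (runProfile F.L R) ped cellP) (physV n F.L hn (Nat.lt_of_lt_of_le Nat.zero_lt_two (two_le_L F))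
        (fun K => tcap d (dcapOf Prod.fst T (memOf ped liveC (cellOfR n F.L (runProfile F.L R) ped cellP)) K))
        (fun K => one_le_tcap d (dcapOf Prod.fst T (memOf ped liveC (cellOfR n F.L (runProfile F.L R) ped cellP)) K)) (runProfile F.L R) ped cellP) K τ) ≤
        ∏ q ∈ memOf ped liveC (cellOfR n F.L (runProfile F.L R) ped cellP) K τ,
          pshapeTH Prod.fst O C 1 1 (R K) (D.C ⟨K, F.m, g₀ K⟩).flow.g 0 (κ' K q) q.2 * Real.exp (-(8 / C.E₂ * totalCostT Prod.fst C K (R K) q.2 + 4 * (partnerAges (PEv.step ∘ Prod.fst) q.2 : ℝ)))) →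
      -- the seam's other inputs: NE7c's shell weight bound, NE7's core budget, four summable rates
        ShellWeightBound l₀ T A A' shA shB Wsh →
        ReindexedBudget l₀ vol T (fun K t τ => A K t τ - shA K t τ) (fun K t τ => A' K t τ - shB K t τ)
          (badOfClass (bstrOf Prod.fst (memOf ped liveC (cellOfR n F.L (runProfile F.L R) ped cellP))) T
          (fun K _ => badClasses Prod.fst (memOf ped liveC (cellOfR n F.L (runProfile F.L R) ped cellP)) jhalf T K)) Cc Rr CcRec RrRec ν u s₂ q₀ r s →
        Summable r →
        Summable u →
        Summable s →
        Summable s₂ →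
    ∃ K₁ K₂, K₀ ≤ K₁ ∧ HybridNE7 l₀ vol (fun K => T (K₁ + (K₂ + K))) (fun K => A (K₁ + (K₂ + K)))
      (fun K => A' (K₁ + (K₂ + K)))
      (fun K => badOfClass (bstrOf Prod.fst (memOf ped liveC (cellOfR n F.L (runProfile F.L R) ped cellP))) T
        (fun K _ => badClasses Prod.fst (memOf ped liveC (cellOfR n F.L (runProfile F.L R) ped cellP)) jhalf T K) (K₁ + (K₂ + K)))
      (fun K => 1 * recordsBudget (birthMass C) C.κ₁ ((n : ℝ) ^ d) ((F.L : ℝ) ^ d) (Real.log 2) jhalf (K₁ + (K₂ + K)))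
      (fun K => shA (K₁ + (K₂ + K))) (fun K => shB (K₁ + (K₂ + K))) (fun K => Wsh (K₁ + (K₂ + K)))
      (fun K => (r (K₁ + (K₂ + K)) + u (K₁ + (K₂ + K))) + (s (K₁ + (K₂ + K)) + s₂ (K₁ + (K₂ + K)))) := by
  -- thresholds: the flow side from `BetaPertHyp`; the infrared clause AND THE LEVEL from `g₁`; NO (B) side
  obtain ⟨hβ₁, hβhalf⟩ := HistoryRealiseCellsRunPinned.beta0_le_of_L_mul_le (F := F) hLβ
  obtain ⟨γ₀, b, β', _hγ₀, hb, _hbβ, hlo, hhi, γf, hγf, hγf₀, hS⟩ :=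
    flowSide_of_betaPertHyp D hβ hβ₀ hβ₁ hLβ (max C.p₀ rr)
  refine ⟨γf, hγf, fun γ hγ hγle => ?_⟩
  obtain ⟨hSm, hγβ⟩ := hS γ hγ hγle
  -- row S6g′'s class-linear constant `Θ` (the left side of the END's `hθJ`, verbatim), paid at the level `P := C.A₀·x_Θ^(C.p₀)`
  let Θ : ℝ := (2 +
      ((2 * (((2 * cth 32 1 sS + 1) ^ d : ℕ) : ℝ) * ((((2 * 32 + 1) ^ d : ℕ) : ℝ) * (4 * 2 ^ d)) +
      4 * ((((2 * cth 32 1 sS + 1) ^ d : ℕ) : ℝ) * (5 : ℝ) ^ d)) / (1 - θc) +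
      2 * (2 * ((((2 * cth 32 1 sS + 1) ^ d : ℕ) : ℝ) * (5 : ℝ) ^ d))) +
      (2 * ((0 + 2 * Real.log (2 * d + 1)) + (2 * (d : ℝ) + 2 * Real.log (2 * d + 1)) *
      (((max 1 (2 * 32 + 2) : ℕ) : ℝ) * (2 * ((((2 * cth 32 1 sS + 1) ^ d : ℕ) : ℝ) * (5 : ℝ) ^ d)))) +
      (2 * (d : ℝ) + 2 * Real.log (2 * d + 1)) * 1 *
      (((max 1 (2 * 32 + 2) : ℕ) : ℝ) *
      ((2 * (((2 * cth 32 1 sS + 1) ^ d : ℕ) : ℝ) * ((((2 * 32 + 1) ^ d : ℕ) : ℝ) * (4 * 2 ^ d)) +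
      4 * ((((2 * cth 32 1 sS + 1) ^ d : ℕ) : ℝ) * (5 : ℝ) ^ d)) / (1 - θc)) +
      4 * 2 ^ d)) +
      10) + 8 * 2 ^ d * Real.log (2 * d + 1)
  refine ⟨min (min 1 (Real.exp (-(irThresholdTLE C F.L rr β₀) / 2))) (Real.exp (-((max 1 (Θ / (θ * C.A₀)) + 1) / 2))),
    lt_min (lt_min one_pos (Real.exp_pos _)) (Real.exp_pos _), fun g hg hgle g₀ ht => ?_⟩
  have hir : irThresholdTLE C F.L rr β₀ ≤ Real.log (g ^ 2)⁻¹ :=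
    HistoryRealiseCellsRunPinned.le_log_inv_sq_of_le_exp hg ((hgle.trans (min_le_left _ _)).trans (min_le_right _ _))
  intro ι _ α π _ _ l₀ vol K₀ T A A' shA shB Cc Rr CcRec RrRec ν u s₂ q₀ r s Wsh R hR hR1 ped cellP liveC Zd H hstep hDJ hBB κ κ'
    hκ hκ' hA0 hA0' qA qB hqA hqB fibM fibM' hPq hPq' hSh hTB hr hu hs hs₂
  obtain ⟨hP1, hθJ, hP⟩ := HistoryFlowProfileLevel.thresholdPaid_of_coupling D h hA₀ hθ Θ hb.le hlo hhi
    (hγle.trans hγf₀) hγβ hSm hβhalf ht hg (hgle.trans (min_le_right _ _)) K₀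
  exact hybridNE7_of_realisedDomainsRunW_printedT3bPDTL_rel D h hμ d n hκ₁ hE₀ hb.le hlo hhi (hγle.trans hγf₀) hγβ hSm
    (le_max_left _ _) (le_max_right _ _) hβhalf ht hir hP1 hP R hR (HistoryRealiseCellsRunPinned.four_le_L F) hn₁ hR1
    ped cellP liveC Zd H hn hstep hDJ hBB hθ.le hslack hE₂ hE₃ hsS hsmall hθc0 hθc1 hθcs hθJ κ κ' hκ hκ' hA0 hA0' hqA hqB
    fibM fibM' hPq hPq' hSh hTB hr hu hs hs₂

end Pinned

end

end Summit.QuantumFields.BalabanUV.T4Continuum.NE7b.RealisedPinnedRelPDWTL
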